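import Summits.HubbardSuperconductivity.HubbardSuperconductivity.Theorems.AnisotropyChordKnnTopSectors

/-!
# Route `AnisotropyChord` / H0 rotor rung, K_{n,n} sibling of XY-LM₀: the ISOTROPIC POINT `Δ = 1` (`η = 0`)
(prover seat `hubbard-h0-rotor-p1` g13)

At `η = 0` the block `P_M(0)` is diagonal with the strictly increasing entries `J(J+1)/2`, so a variational top vector is
supported on the top level `J = 2s` and `⟨J(J+1)⟩ = 2s(2s+1)` in every sector: `XYLiebMattisKnn n 1` for every `n`
(the `SU(2)` point: all sectors carry the fully polarised multiplet).  Complements `…KnnInterval32` (`Δ ∈ [0, 63/64]`); the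
perturbative corner `Δ ∈ (63/64, 1)` stays uncovered.
-/

set_option linter.dupNamespace false
set_option autoImplicit false

noncomputable section

open Finset Matrix

namespace Summit.HubbardSuperconductivity.HubbardSuperconductivity.Theorems.AnisotropyChord.Knn

/-- at `η = 0` the couplings vanish. [folklore] -/
theorem cK_zero (twoS : ℕ) (M : ℤ) (k : ℕ) : cK twoS M 0 k = 0 := by unfold cK; simp

/-- at `η = 0` the diagonal is `J(J+1)/2 = fK/2`. [folklore] -/
theorem pK_zero (twoS : ℕ) (M : ℤ) (k : ℕ) : pK twoS M 0 k = fK twoS M k / 2 := by unfold pK fK; simp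

/-- at `η = 0` the quadratic form is `½ Σ f_k x_k²`. [folklore] -/
theorem quadForm_zero (twoS : ℕ) (M : ℤ) (y : Fin (numLevels twoS M) → ℝ) :
    y ⬝ᵥ (knnBlock twoS M 0 *ᵥ y) = (1/2 : ℝ) * ∑ k ∈ range (numLevels twoS M), fK twoS M k * ext0 y k ^ 2 := by
  rw [knnBlock_eq_jac, jac_quadForm, Finset.mul_sum]
  refine Finset.sum_congr rfl fun k _ => ?_
  rw [pK_zero, cK_zero]; ring

/-- **at `η = 0` every top vector has `⟨J(J+1)⟩ = 2s(2s+1)`** (it is supported on the top level). [folklore] -/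
theorem casimirMean_eq_top_of_eta_zero {twoS : ℕ} {M : ℤ} (hM : M.natAbs ≤ twoS)
    {x : Fin (numLevels twoS M) → ℝ} (hx : IsTopVector (knnBlock twoS M 0) x) :
    casimirMean twoS M x = (twoS : ℝ) * ((twoS : ℝ) + 1) := by
  have hm1 : 1 ≤ numLevels twoS M := numLevels_pos twoS M
  -- the top basis vector
  obtain ⟨e, he⟩ : ∃ e : Fin (numLevels twoS M) → ℝ, ∀ k, e k = if k.val = numLevels twoS M - 1 then 1 else 0 :=
    ⟨fun k => if k.val = numLevels twoS M - 1 then 1 else 0, fun _ => rfl⟩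
  have hee : ∀ k, ext0 e k = if k = numLevels twoS M - 1 then 1 else 0 := by
    intro k; unfold ext0
    by_cases hk : k < numLevels twoS M
    · rw [dif_pos hk, he]
    · rw [dif_neg hk, if_neg (by omega)]
  have hnorm : e ⬝ᵥ e = 1 := by
    rw [← sum_range_ext0_sq, Finset.sum_eq_single (numLevels twoS M - 1)]
    · rw [hee, if_pos rfl]; norm_num
    · intro k _ hk; rw [hee, if_neg hk]; norm_num
    · intro h; exfalso; exact h (mem_range.mpr (by omega))
  have hquad : e ⬝ᵥ (knnBlock twoS M 0 *ᵥ e) = (1/2 : ℝ) * fK twoS M (numLevels twoS M - 1) := by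
    rw [quadForm_zero, Finset.sum_eq_single (numLevels twoS M - 1)]
    · rw [hee, if_pos rfl]; ring
    · intro k _ hk; rw [hee, if_neg hk]; ring
    · intro h; exfalso; exact h (mem_range.mpr (by omega))
  have htop : fK twoS M (numLevels twoS M - 1) = (twoS : ℝ) * ((twoS : ℝ) + 1) := by
    unfold fK; rw [lev_top twoS hM]
  -- the variational inequality against e
  have hvar := hx.2.2 e
  rw [hnorm, mul_one, hquad, quadForm_zero, ← sum_range_ext0_sq] at hvar
  have hle : ∀ k ∈ range (numLevels twoS M),
      fK twoS M k * ext0 x k ^ 2 ≤ fK twoS M (numLevels twoS M - 1) * ext0 x k ^ 2 := by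
    intro k hk
    exact mul_le_mul_of_nonneg_right (fK_mono twoS M (by have := mem_range.mp hk; omega)) (sq_nonneg _)
  have hsum_le : ∑ k ∈ range (numLevels twoS M), fK twoS M k * ext0 x k ^ 2
      ≤ fK twoS M (numLevels twoS M - 1) * ∑ k ∈ range (numLevels twoS M), ext0 x k ^ 2 := by
    rw [Finset.mul_sum]; exact Finset.sum_le_sum hle
  have heq : ∑ k ∈ range (numLevels twoS M), fK twoS M k * ext0 x k ^ 2
      = fK twoS M (numLevels twoS M - 1) * ∑ k ∈ range (numLevels twoS M), ext0 x k ^ 2 :=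
    le_antisymm hsum_le (by linarith)
  have hpos := sum_range_ext0_sq_pos hx.1
  rw [casimirMean_eq, heq, htop, mul_div_assoc, div_self hpos.ne', mul_one]

/-- **`XYLiebMattisKnn n 1` for every `n`** (the isotropic point: `⟨J(J+1)⟩ = 2s(2s+1)` in every sector).
[conjecture: theory seat hubbard-h0-rotor-theory-1, cycle 12 — decided instances; Lean proof here (trivial SU(2) point)] -/
theorem xyLiebMattisKnn_one (twoS : ℕ) : XYLiebMattisKnn twoS 1 := by
  intro M M' hMM' hM' x x' hx hx'
  have hM : M.natAbs ≤ twoS := by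
    have : ((M.natAbs : ℕ) : ℤ) ≤ M'.natAbs := by rw [Int.natCast_natAbs, Int.natCast_natAbs]; exact hMM'
    have : M.natAbs ≤ M'.natAbs := by exact_mod_cast this
    exact this.trans hM'
  have e1 : (1 : ℝ) - 1 = 0 := by norm_num
  rw [e1] at hx hx'
  rw [casimirMean_eq_top_of_eta_zero hM hx, casimirMean_eq_top_of_eta_zero hM' hx']

end Summit.HubbardSuperconductivity.HubbardSuperconductivity.Theorems.AnisotropyChord.Knn
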